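import Literature.Topology.FourManifolds.HCobordismMorseHomologyFree
import Literature.AlgebraicTopology.SingularHomology.EulerCharacteristicTriple
import HarnessLib

/-!
# `H_i(W_k, W_{k-1}; M₀) = 0` for `i ≠ k` and `H_k(W, W_k; M₀) = 0` for a nice Morse function,
# with arbitrary coefficients

Topic `Literature/Topology/FourManifolds`.  Milnor, *Lectures on the h-cobordism theorem* (1965),
Cor. 3.15 with the Remark after Thm. 3.14 (PDF pp. 19–21) and PDF p. 48: for a nice
(self-indexing) Morse function `g` on a cobordism, `W_k = {g ≤ cutLevel n (k + 1)}`, the pair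
`(W_k, W_{k-1})` has homology concentrated in degree `k` (*"`H⁎(W, V)` is isomorphic to
`ℤ ⊕ … ⊕ ℤ` in dimension `λ` and is zero otherwise"*), whence, by the exact sequences of the
triples `(W, W_{j+1}, W_j)` (Hatcher 2002, §2.1 p. 118; the argument of Milnor's proof of
Thm. 7.4, PDF p. 48), `H_k(W, W_k) = 0`.

The tree proves the first statement with integer coefficients
(`Literature.Topology.FourManifolds.Cobordism.Milnor1965_morseHomology_free_holds`,
`HCobordismMorseHomologyFree.lean`).  Its proof — Thm. 3.14 (`W_{k-1} ∪ ⋃ₚ D_L(p)` is a strong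
deformation retract of `W_k`, `Cobordism.isStrongDeformationRetractOf_setOf_le` with the discharge
`Cobordism.Milnor1965_deformationRetract_leftHandDiscs_holds`), Hatcher's Prop. 2.19, and the
relative homology of finitely many attached cells off their dimension
(`isZero_relativeSingularHomology_union_iUnion_range`) — works for every coefficient module, and
this file records it in that generality, together with the consequence for `H_k(W, W_k)`:

* `Cobordism.IsNiceMorseFunction.isZero_relativeSingularHomology_cutLevel_pair_of_ne` —
  `H_i(W_k, W_{k-1}; M₀) = 0` for `i ≠ k`;
* `Cobordism.IsNiceMorseFunction.isZero_relativeSingularHomology_univ_cutLevel` —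
  `H_k(W, W_k; M₀) = 0` (downward induction over the triples `(W, W_{j+1}, W_j)`, `j ≥ k`, from
  `W_{n+1} = W`).

Both are needed with complex coefficients by the rigidity of natural de Rham comparisons
(`Literature.AlgebraicGeometry.HodgeTheory.NaturalDeRhamComparisonRigidity`).  Everything is
proved; no definitions, no named facts.

## References

* J. Milnor, *Lectures on the h-cobordism theorem*, notes by L. Siebenmann and J. Sondow,
  Princeton Mathematical Notes (1965): Thm. 3.14, Cor. 3.15 and Remark (PDF pp. 19–21), Def. 4.9
  (PDF p. 25), proof of Thm. 7.4 (PDF p. 48). [MilnorHCobordism1965]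
* A. Hatcher, *Algebraic Topology*, CUP 2002, §2.1 p. 118 (exact sequence of a triple),
  Prop. 2.19, Lemma 2.34 (a). [HatcherAT2002]
-/

open scoped Manifold ContDiff Topology
open Set Function Filter CategoryTheory Limits
open Literature.AlgebraicTopology.Homotopy Literature.AlgebraicTopology.SingularHomology

noncomputable section

namespace Literature.Topology.FourManifolds

universe u v

variable (R : Type v) [CommRing R] (M₀ : Type v) [AddCommGroup M₀] [Module R M₀]

namespace Cobordism

variable {n : ℕ} {M N : Type u} [TopologicalSpace M] [T2Space M] [SecondCountableTopology M]
  [ChartedSpace ((EuclideanSpace ℝ (Fin n))) M] [IsManifold (𝓡 n) ∞ M] [CompactSpace M]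
  [TopologicalSpace N] [T2Space N] [SecondCountableTopology N] [ChartedSpace ((EuclideanSpace ℝ (Fin n))) N]
  [IsManifold (𝓡 n) ∞ N] [CompactSpace N]

/-- **Milnor 1965, Cor. 3.15 with the Remark after Thm. 3.14, vanishing half, any coefficients:
`H_i(W_k, W_{k-1}; M₀) = 0` for `i ≠ k`**, for a nice Morse function `g` on the cobordism `c`
(`W_k = {g ≤ cutLevel n (k + 1)}`; *"`H⁎(W, V)` … is zero otherwise"*, PDF pp. 19–21).  Proof as
in the tree's integral `Milnor1965_morseHomology_free_of_deformationRetract`: Thm. 3.14 makes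
`W_{k-1} ∪ ⋃ₚ D_L(p)` a strong deformation retract of `W_k`, and finitely many disjoint closed
`k`-cells attached to a closed set carry no relative homology off degree `k` (Hatcher 2002,
Lemma 2.34 (a)).  For `k > n + 1 = dim W` the pair is `(W, W)`.
[cite: MilnorHCobordism1965, Thm. 3.14, Cor. 3.15 and Remark (PDF pp. 19–21)] [cite: HatcherAT2002, Prop. 2.19, Lemma 2.34 (a)] -/
theorem IsNiceMorseFunction.isZero_relativeSingularHomology_cutLevel_pair_of_ne
    {c : Cobordism n M N} {g : c.W → ℝ} (hg : c.IsNiceMorseFunction g) {k i : ℕ} (hik : i ≠ k) :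
    IsZero (relativeSingularHomology R M₀ ↥{z : c.W | g z ≤ cutLevel n (k + 1)}
      {z : ↥{z : c.W | g z ≤ cutLevel n (k + 1)} | g z.1 ≤ cutLevel n k} i) := by
  classical
  have hgM : c.IsMorseFunction g := hg.1
  have hgc : Continuous g := hgM.isMorse.contMDiff.continuous
  have hgd : MDifferentiable (𝓡∂ (n + 1)) 𝓘(ℝ, ℝ) g :=
    hgM.isMorse.contMDiff.mdifferentiable (by simp)
  rcases Nat.lt_or_ge (n + 1) k with hk | hk
  · -- `k > dim W`: `W_k = W_{k-1} = W`
    have huniv : {z : ↥{z : c.W | g z ≤ cutLevel n (k + 1)} | g z.1 ≤ cutLevel n k} = univ :=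
      eq_univ_of_forall fun z => hgM.apply_le_cutLevel (by omega) z.1
    rw [huniv]
    exact isZero_relativeSingularHomology_univ R M₀ i
  -- `k ≤ dim W`: the slab `c_k = g⁻¹[a, b]`
  set a : ℝ := cutLevel n k with ha_def
  set b : ℝ := cutLevel n (k + 1) with hb_def
  have ha : 0 ≤ a := (cutLevel_zero n).symm.trans_le (cutLevel_mono n (Nat.zero_le k))
  have hab : a < b := cutLevel_strictMono n (Nat.lt_succ_self k)
  have hb1 : b ≤ 1 := (cutLevel_mono n (show k + 1 ≤ n + 2 by omega)).trans_eq (cutLevel_eq_one n)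
  have hreg : ∀ z ∈ criticalSet (𝓡∂ (n + 1)) g, g z ≠ a ∧ g z ≠ b := fun z hz =>
    ⟨hg.apply_ne_cutLevel hz k, hg.apply_ne_cutLevel hz (k + 1)⟩
  have hval : ∀ z ∈ criticalSet (𝓡∂ (n + 1)) g, g z ∈ Ioo a b → g z = niceLevel n k := by
    intro z hz hzI
    rw [hg.2 z hz, (hg.morseIndex_eq_iff_apply_mem_Ioo hz).mpr hzI]
  have hlev : ∀ z ∈ criticalSet (𝓡∂ (n + 1)) g, ∀ z' ∈ criticalSet (𝓡∂ (n + 1)) g,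
      g z ∈ Ioo a b → g z' ∈ Ioo a b → g z = g z' := fun z hz z' hz' hzI hz'I => by
    rw [hval z hz hzI, hval z' hz' hz'I]
  -- a gradient-like vector field (Lemma 3.2, proved)
  obtain ⟨ξ, hξ⟩ := Cobordism.Milnor1965_exists_isGradientLike_holds (c := c) hgM
  have hv : ContMDiff (𝓡∂ (n + 1)) (𝓡∂ (n + 1)).tangent 1
      (fun y ↦ (⟨y, ξ y⟩ : TangentBundle (𝓡∂ (n + 1)) c.W)) :=
    ξ.contMDiff.of_le (WithTop.coe_le_coe.mpr le_top)
  -- the critical points of the slab and their left-hand discs, closed `k`-cells (Def. 3.9)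
  set P : Set c.W := criticalSet (𝓡∂ (n + 1)) g ∩ g ⁻¹' Ioo a b with hP_def
  have hP : P = criticalSetOfIndex (𝓡∂ (n + 1)) g k := hg.criticalSet_inter_preimage_Ioo k
  have hPfin : P.Finite :=
    (IsMorse.finite_criticalSet_holds (I := 𝓡∂ (n + 1)) (M := c.W) hgM.isMorse).subset
      inter_subset_left
  haveI : Finite ↥P := hPfin.to_subtype
  have hnoval : ∀ p ∈ P, ∀ z ∈ criticalSet (𝓡∂ (n + 1)) g, g z ∉ Ico a (g p) := by
    intro p hp z hz hzI
    have hzt : g z ∈ Ioo a b :=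
      ⟨lt_of_le_of_ne hzI.1 (hreg z hz).1.symm, hzI.2.trans hp.2.2⟩
    exact (hlev z hz p hp.1 hzt hp.2 ▸ hzI.2).false
  choose Φ hΦinj hΦrange hΦlev using fun p : ↥P =>
    Cobordism.Milnor1965_leftHandDisc_isDisc_holds hgM ξ hξ ha p.2.1 p.2.2.1 (hnoval p p.2)
  have hd : ∀ p : ↥P, morseIndex (𝓡∂ (n + 1)) g p = k := fun p => by
    have hp : (p : c.W) ∈ criticalSetOfIndex (𝓡∂ (n + 1)) g k := hP ▸ p.2
    exact hp.2
  -- the set `V = W_{k-1}` and the attachment data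
  set V : Set c.W := {z : c.W | g z ≤ a} with hV_def
  have hxD : ∀ (p : ↥P) x, Φ p x ∈ leftHandDisc (𝓡∂ (n + 1)) g ξ p a := fun p x => by
    rw [← hΦrange p]
    exact mem_range_self x
  have hVcl : IsClosed V := isClosed_le hgc continuous_const
  have hmem : ∀ (p : ↥P) x, Φ p x ∈ V ↔
      ‖(x : EuclideanSpace ℝ (Fin (morseIndex (𝓡∂ (n + 1)) g p)))‖ = 1 := fun p x => by
    rw [← hΦlev p x]
    exact ⟨fun hle => le_antisymm hle (hxD p x).2, fun heq => heq.le⟩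
  have hdisj : Pairwise fun p q : ↥P => Disjoint (range (Φ p)) (range (Φ q)) := fun p q hpq => by
    change Disjoint (range (Φ p)) (range (Φ q))
    rw [hΦrange p, hΦrange q]
    exact (disjoint_stableSet hv (Subtype.coe_ne_coe.mpr hpq)).mono inter_subset_left
      inter_subset_left
  -- Thm. 3.14: `V ∪ ⋃ₚ D_L(p)` is a strong deformation retract of `W_k = {g ≤ b}`
  have hSDR := isStrongDeformationRetractOf_setOf_le
    Cobordism.Milnor1965_deformationRetract_leftHandDiscs_holds hgM ξ hξ ha hab hb1 hreg hlev
  have hunion : (V ∪ ⋃ p ∈ P, leftHandDisc (𝓡∂ (n + 1)) g ξ p a) = V ∪ ⋃ p : ↥P, range (Φ p) := by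
    congr 1
    ext x
    simp only [mem_iUnion, exists_prop]
    constructor
    · rintro ⟨p, hp, hx⟩
      refine ⟨⟨p, hp⟩, ?_⟩
      rw [hΦrange ⟨p, hp⟩]
      exact hx
    · rintro ⟨p, hx⟩
      rw [hΦrange p] at hx
      exact ⟨p, p.2, hx⟩
  rw [hunion] at hSDR
  have hVA : V ⊆ V ∪ ⋃ p : ↥P, range (Φ p) := subset_union_left
  have hAS : V ∪ ⋃ p : ↥P, range (Φ p) ⊆ {z : c.W | g z ≤ b} := by
    refine union_subset (fun z hz => le_trans hz hab.le) (iUnion_subset fun p => ?_)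
    rw [hΦrange p]
    exact fun x hx => (hξ.apply_le_of_mem_stableSet hgd hx.1).trans p.2.2.2.le
  -- `H_i(W_k, W_{k-1}) ≅ H_i(V ∪ ⋃ₚ D_L(p), V)` (Hatcher Prop. 2.19), and the cell computation
  have e : relativeSingularHomology R M₀ ↥(V ∪ ⋃ p : ↥P, range (Φ p)) (Subtype.val ⁻¹' V) i ≅
      relativeSingularHomology R M₀ ↥{z : c.W | g z ≤ b} (Subtype.val ⁻¹' V) i :=
    hSDR.relativeSingularHomologyIso R M₀ hAS hVA i
  exact (isZero_relativeSingularHomology_union_iUnion_range R M₀ hVcl Φ hmem hΦinj hdisj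
    (fun p => by rw [hd p]; exact hik)).of_iso e.symm

/-- **`H_k(W, W_k; M₀) = 0` for a nice Morse function** (`W_k = {g ≤ cutLevel n (k + 1)}`; Milnor
1965, proof of Thm. 7.4, PDF p. 48, with Cor. 3.15: the critical points above `W_k` have index
`> k`).  Downward induction on `j ≥ k` over the exact sequences
`H_k(W_{j+1}, W_j) → H_k(W, W_j) → H_k(W, W_{j+1})` of the triples `(W, W_{j+1}, W_j)` (Hatcher
2002, §2.1 p. 118), starting from `W_{n+1} = W`, with
`isZero_relativeSingularHomology_cutLevel_pair_of_ne` (`k ≠ j + 1`).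
[cite: MilnorHCobordism1965, proof of Thm. 7.4 (PDF p. 48), Cor. 3.15 (PDF p. 19)] [cite: HatcherAT2002, §2.1 p. 118] -/
theorem IsNiceMorseFunction.isZero_relativeSingularHomology_univ_cutLevel
    {c : Cobordism n M N} {g : c.W → ℝ} (hg : c.IsNiceMorseFunction g) (k : ℕ) :
    IsZero (relativeSingularHomology R M₀ c.W {z : c.W | g z ≤ cutLevel n (k + 1)} k) := by
  have hgM : c.IsMorseFunction g := hg.1
  -- `H_k(W, W_{k+m}) = 0` for all `m`, by downward induction from `m` large
  suffices key : ∀ m : ℕ, n + 1 ≤ k + m →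
      IsZero (relativeSingularHomology R M₀ c.W {z : c.W | g z ≤ cutLevel n (k + m + 1)} k) by
    have h : ∀ m : ℕ, IsZero (relativeSingularHomology R M₀ c.W {z : c.W | g z ≤ cutLevel n (k + m + 1)} k) := by
      intro m
      induction hm : n + 1 - (k + m) generalizing m with
      | zero => exact key m (Nat.sub_eq_zero_iff_le.1 hm)
      | succ d ih =>
        -- the triple `(W, W_{k+m+1}, W_{k+m})`
        have hsub : {z : c.W | g z ≤ cutLevel n (k + m + 1)} ⊆ {z : c.W | g z ≤ cutLevel n (k + (m + 1) + 1)} :=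
          fun z hz => le_trans hz (cutLevel_mono n (by omega))
        refine (GradedLES.ofTriple R M₀ hsub).isZero_B k ?_ (ih (m + 1) (by omega))
        exact hg.isZero_relativeSingularHomology_cutLevel_pair_of_ne R M₀ (k := k + m + 1) (by omega)
    simpa using h 0
  intro m hm
  have huniv : {z : c.W | g z ≤ cutLevel n (k + m + 1)} = univ :=
    eq_univ_of_forall fun z => hgM.apply_le_cutLevel (by omega) z
  rw [huniv]
  exact isZero_relativeSingularHomology_univ R M₀ k

/-- **`H_k(W_k; M₀) → H_k(W; M₀)` is onto for a nice Morse function** (exactness of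
`H_k(W_k) → H_k(W) → H_k(W, W_k)` and `H_k(W, W_k) = 0`; Milnor 1965, proof of Thm. 7.4).
[cite: MilnorHCobordism1965, proof of Thm. 7.4 (PDF p. 48)] [cite: HatcherAT2002, §2.1 p. 117 (exact sequence of a pair)] -/
theorem IsNiceMorseFunction.surjective_map_subsetIncl_cutLevel
    {c : Cobordism n M N} {g : c.W → ℝ} (hg : c.IsNiceMorseFunction g) (k : ℕ) :
    Function.Surjective (singularHomology.map R M₀
      (subsetIncl {z : c.W | g z ≤ cutLevel n (k + 1)}) k) := by
  have hZ := hg.isZero_relativeSingularHomology_univ_cutLevel R M₀ k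
  have hex := relativeSingularHomology.exact_map_ofAbsolute R M₀ {z : c.W | g z ≤ cutLevel n (k + 1)} k
  rw [ShortComplex.moduleCat_exact_iff_range_eq_ker] at hex
  intro x
  haveI := ModuleCat.subsingleton_of_isZero hZ
  have hx : x ∈ LinearMap.ker (relativeSingularHomology.ofAbsolute R M₀ c.W
      {z : c.W | g z ≤ cutLevel n (k + 1)} k).hom := by
    rw [LinearMap.mem_ker]
    exact Subsingleton.elim _ _
  rw [← hex] at hx
  exact hx

end Cobordism

end Literature.Topology.FourManifolds

end
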